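import Summits.NavierStokesRegularity.NavierStokesRegularity.Theses.SymmetryModuliCount
import Literature.Analysis.FluidPDE.TypeIAncientMild
import Literature.Analysis.FluidPDE.AxisymmetricEuler
import Literature.Analysis.FluidPDE.KNSSAxisymmetricNoSwirlHolds
import Mathlib.MeasureTheory.Measure.OpenPos

/-!
# Line `swirl-barrier-past` — crux `SymmetricLiouville` (stmt-NavierStokesRegularity-4053, route SymmetryModuliCount)

Skeleton of the line built from the crux idea `Cruxes/SymmetricLiouville/Ideas/swirl-barrier-past.md`
(ideator 1; first lemmas machine-checked in `Cruxes/SymmetricLiouville/SketchIdeator1.lean`, decls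
`SwirlBarrier`, `AxisymmetricLeafOfCOverR`) as sharpened by the three triage notes
`TRIAGE-r1-{1,2,3}.md` (all: pass — "the supersolution computation is correct; the comparison principle
for (5.10) in the linear-growth class is the only real work of the lever; the card is the independent
fallback for the swirl half of leaf R₀ and is subsumed if the sibling Oseen bootstrap (Lemma B-axis)
holds"). Gen 1 by planner `planner-cruxplan-stmt-NavierStokesRegularity-4053-swirl-barrier-past-0`,
2026-08-16. SIX registered stubs (two of them FOREIGN leaves of the crux that every line for this
crux must carry) plus the no-swirl endgame PROVED in this file (`noSwirlEndgame`, from the tree's KNSS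
Thm 5.2 + the gauge); the composition `SymmetricLiouville_of` is pure logic and kernel-checked; every
stub signature is written in TREE VOCABULARY ONLY
(`Literature.Analysis.FluidPDE.IsTypeIAncientMild`, `IsAxisymmetric`, `swirl`, `cylRadius`, `fderiv`,
`timeDeriv`),
so a `Theorems/` file proves a stub verbatim without importing this module.

THE CRUX (fixed, route decl `Theses.SymmetryModuliCount.SymmetricLiouville`): a smooth, divergence-free,
KNSS-mild ancient field with the Type-I time bound `‖u(t,x)‖ ≤ C/√(−t)` (class `A_C`; in the tree this
hypothesis block is literally `IsTypeIAncientMild C u`, `isTypeIAncientMild_iff`) which is annihilated by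
the generator `L_ξ u = ∇u·(a + σx + Ax) + σu + 2σt∂ₜu − Au` of a nonzero `ξ = (a, σ, A) ∈ sim(3)`
(`A` skew) vanishes on `t < 0`.

THE LEVER (stub 4, `stub_swirlBarrier`). For an AXISYMMETRIC element of `A_C` the scale-invariant swirl
`Γ = r u_θ = swirl (u t)` solves KNSS (5.10), `Γ_t + u·∇Γ + (2/r)Γ_r = ΔΓ` off the axis (tree:
`swirl_transport_holds` for the classical solution supplied on every window by
`IsTypeIAncientMild.exists_isClassicalNSSolutionOn_Ioo`), vanishes on the axis and grows at most like
`C r/√(−t)`. The explicit function started at time `s < 0`,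
`ψ_s(t,x) = (C/√(−s)) · (r + 2C(√(−s) − √(−t)))`, satisfies
`(∂ₜ + u·∇ + (2/r)∂ᵣ − Δ)ψ_s = (C/√(−s))(C/√(−t) + u_r + 1/r) > 0` (ONLY `|u_r| ≤ C/√(−t)` is used),
dominates `Γ(s,·)` and is `≥ 0 = Γ` on the axis; the comparison principle on `[s, t₀] × ℝ³` in the
linear-growth class (bounded drift `C/√(−t₀)`, barrier `εe^{μ(t−s)}(1 + |x|²)`, exactly the pattern of
the tree's `SwirlMaximumPrinciple.weak_max_principle` / `abs_swirl_le_of_classical`) gives `Γ ≤ ψ_s`;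
letting `s → −∞` at fixed `(t,x)`: `ψ_s(t,x) → 2C²`. With `−Γ`: `|Γ| ≤ 2C²` — an ancient solution has no
initial time at which to start a maximum principle; the barrier from `s = −∞` is the substitute, and it
works because the Type-I SLOPE `C/√(−s)` of the admissible linear growth vanishes in the past while the
accumulated drift allowance stays bounded (`= 2C²(1 − √(t/s))`).

THE LINE. Case split on `ξ = (a, σ, A)` (proved in `SymmetricLiouville_of`):
* `σ ≠ 0` (spiral scalings, every rate, plain self-similar included): `stub_spiralLeaf` — FOREIGN to this
  line (sibling lines `farfield-recentring-critical-rate` ≈ `stabiliser-at-infinity-decay`: recentring +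
  Oseen bootstrap put the profile in Pineau–Vicol's class (1.10); Tsai 1998 Thm 1 (`A = 0`, tree theorem
  `tsai_selfsimilar_bounded_holds`) and the named fact `pineauVicol2026_rss_liouville` close it OUTSIDE a
  compact window of rotation rates; the window `α₁(C) ≤ |α| ≤ α₂(C)` is Pineau–Vicol Conj. 1.1 = Tsai 2018
  Conj. 8.9 — OPEN, `Disproof.RotatedSelfSimilarLiouvilleDecaying`). HARDEST stub overall.
* `σ = 0` and `a` NOT orthogonal to `ker A` (translations `A = 0, a ≠ 0`; helical screws `A ≠ 0`, nonzero
  pitch): `stub_screwLeaf` — FOREIGN/KNOWN (translation leaf = tree theorem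
  `KNSS2009_typeI_rate_liouville_holds`; nonzero pitch = sibling line `blowdown-kills-pitch` ≈
  `screw-lattice-blowdown`: the screw contains a lattice translation, blow-down shrinks the period,
  ε-Liouville at `−∞`; `Disproof.HelicalTypeILiouville`).
* `σ = 0`, `a ⊥ ker A` (then `A ≠ 0` since `ξ ≠ 0`): a ROTATION about the shifted axis `−c + ker A`
  (`a = Ac`), i.e. the pitch-0 leaf R₀ "axisymmetric WITH swirl" — THIS LINE:
  `stub_axisNormalForm` (conjugate by a rigid motion into the tree's normal form `IsAxisymmetric`, staying
  in `A_C` with the same `C`) → `stub_swirlBarrier` (the lever: `|Γ| ≤ 2C²`) ∥ `stub_axisFarField` (the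
  field is `o(1/√(−t))` far from the axis in parabolic units — the sibling recentring lemma "Lemma A-axis",
  shared input of BOTH residual routes) → `stub_swirlLiouville` (the RESIDUAL of the line: a bounded
  scale-invariant swirl of an axisymmetric element of `A_C` with small far field vanishes — KNSS Thm 5.3's
  core (5.12)–(5.20) re-run in the Type-I ancient class; two routes, see its docstring) →
  `noSwirlEndgame` (PROVED here: swirl-free axisymmetric elements of `A_C` vanish — KNSS Thm 5.2 on the
  windows `u(· − δ)`, tree theorem `knss_axisymmetric_no_swirl'_holds`, + the gauge
  `IsTypeIAncientMild.eq_zero_of_slice_const`) → transfer back along the rigid motion (proved here).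

DISPROOF USED (`Cruxes/SymmetricLiouville/Disproof.lean`, cdisprove v6, read 2026-08-16; landed
`Theorems/SymmetricLiouville/Negative/{LoadBearing, FinerCuts, AncientLoadBearing}`):
`symmetricLiouville_false_without_typeI` / `_false_with_bounded` — honoured at stub 4 (the barrier is
built from the Type-I bound at time `s` and is VOID for merely bounded fields: the constant field `e₀` has
swirl `−x₁`, unbounded), at stub 1 (blow-down + ε-Liouville at `−∞`), at stub 5 (recentring limits are
killed by the Type-I translation leaf) and at stub 6 (Type-I drift class);
`symmetricLiouville_false_without_mild` — honoured in the proved endgame `noSwirlEndgame` (the parasitic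
field `(1−t)⁻¹e_z` is axisymmetric, swirl-free, Type-I, not mild: the gauge `eq_zero_of_slice_const` is
used exactly there) and at stub 2 (`(−t)^{-1/2}e₀` is self-similar, Type-I, not mild); `symmetricLiouville_false_on_window` /
`_false_typeI_near_zero_bounded_past` / `_false_mild_on_window` — honoured at stub 4 (the limit
`s → −∞` IS the proof; on a finite window the bound `|Γ| ≤ 2C²` FAILS, e.g. a Lamb–Oseen column of small
circulation started inside the window) and at stubs 1, 5. No stub is an instance of a landed Negative
lemma (each carries the full class `IsTypeIAncientMild` on the whole past); no `-- Targets` kill exists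
yet. Sanity: the crux implies stubs 1, 2 (`symmetricLiouville_implies_*`, sorry-free below) and, via the
infinitesimal rotation of an axisymmetric field, stubs 4–6; `A_C ∋ 0` axisymmetric (`stubs_nonvacuous`).

Everything analytic is inside the six `stub_*`; everything else (case split, transfer, the no-swirl
endgame, the bridges to the route's END leaves) is proved.
-/

noncomputable section

set_option linter.dupNamespace false

namespace Summit.NavierStokesRegularity.NavierStokesRegularity.Cruxes.SymmetricLiouville.SwirlBarrierPast

open Literature.Analysis.FluidPDE MeasureTheory Set Function

open Summit.NavierStokesRegularity.NavierStokesRegularity.Theses.SymmetryModuliCount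
  (SymmetricLiouville)

/-- `ℝ³` as in the route file. -/
abbrev E3 : Type := EuclideanSpace ℝ (Fin 3)

/-! ## The six stub signatures and the endgame statement (`Sig.stub_*`, tree vocabulary only) -/

/-- STUB 1 — SCREW LEAF: translations and helical screw motions (`σ = 0`, `a` not orthogonal to
`ker A`; FOREIGN/KNOWN, size L in Lean). If `u ∈ A_C` is annihilated by the Killing generator
`∇u·(a + Ax) − Au` with `A` skew and `⟪a, e⟫ ≠ 0` for some `e ∈ ker A`, then `u ≡ 0` on `t < 0`.
For `A = 0` (`e` arbitrary): `u` is independent of the direction `a ≠ 0` — the 2.5-D leaf, tree THEOREM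
`KNSS2009_typeI_rate_liouville_holds` applied to the bounded windows `u(· − δ)` after rotating `a` to a
coordinate axis (class invariance). For `A ≠ 0`: `a` has a component along the axis `ker A` = nonzero
pitch; the flow of `a + Ax` at angle `2π/‖A‖` is the translation by `(2π/‖A‖)·a_∥ ≠ 0`, so `u(t,·)` is
periodic; blow-down `λu(λ²t, λx)`, `λ → ∞`, stays in `A_C` (same `C`) and shrinks the period to `0`, every
local limit is translation-invariant hence `0`, so `√(−t)‖u(t)‖_∞ → 0` as `t → −∞`, and the ε-Liouville
from `s = −∞` in the Oseen identity + forward uniqueness (`oseenMild_bounded_unique`) give `u ≡ 0`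
(sibling lines `blowdown-kills-pitch` ≈ `screw-lattice-blowdown`; `Disproof.HelicalTypeILiouville`
docstring; input: sequential compactness of `A_C` from the uniform KNSS Prop. 4.1 bounds, print-only).
Why it might FAIL as a proof: the uniform-in-the-class smoothing (KNSS Prop. 4.1 with constants depending
on `C` only) is not in the tree (`knss2009_smoothing` has per-solution constants). The STATEMENT is a
special case of the crux. -/
def Sig.stub_screwLeaf : Prop :=
  ∀ (C : ℝ) (u : ℝ → E3 → E3), IsTypeIAncientMild C u →
    ∀ (a : E3) (A : E3 →L[ℝ] E3), (∀ x, inner ℝ (A x) x = 0) →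
      (∃ e : E3, A e = 0 ∧ inner ℝ a e ≠ 0) →
      (∀ t < 0, ∀ x, fderiv ℝ (u t) x (a + A x) - A (u t x) = 0) →
      ∀ t < 0, ∀ x, u t x = 0

/-- STUB 2 — SPIRAL-SCALING LEAF (`σ ≠ 0`, every skew `A`, every `a`; FOREIGN, contains an OPEN
problem; HARDEST stub overall, XL). If `u ∈ A_C` is annihilated by `∇u·(a + σx + Ax) + σu + 2σt∂ₜu − Au`
with `σ ≠ 0`, then `u ≡ 0`. Normalisation (pure algebra): divide `ξ` by `σ` and translate by
`c = (σ + A)⁻¹a` (`⟪(σ+A)x, x⟫ = σ‖x‖²`), so `u` is backward (rotated) self-similar about `(0, −c)` with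
rotation rate `α ~ ‖A‖/|σ|` and BOUNDED profile `‖U‖ ≤ C`. `A = 0`: Tsai 1998 Thm 1, `q = ∞` (tree theorem
`tsai_selfsimilar_bounded_holds`: a bounded Leray profile is constant) + the gauge
(`IsTypeIAncientMild.eq_zero_of_slice_const`; the parasitic soliton `(−t)^{-1/2}e₀` shows the gauge is
used). `A ≠ 0`: sibling lines `farfield-recentring-critical-rate` ≈ `stabiliser-at-infinity-decay`
(recentring far from the centre degenerates the stabiliser to a translation ⇒ `√(−t)|u| → 0` there;
Oseen bootstrap ⇒ the space–time bound `HasTypeIDecay K` = Pineau–Vicol (1.10); then the named fact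
`pineauVicol2026_rss_liouville` (arXiv:2607.09619 Thm 1.4) for `|α| < α₁(K)` or `|α| > α₂(K)`).
Why it might FAIL: the window `α₁ ≤ |α| ≤ α₂` with decaying profile is Pineau–Vicol Conj. 1.1 = Tsai 2018
Conj. 8.9 (OPEN; `Disproof.RotatedSelfSimilarLiouvilleDecaying`); a nonzero bounded-profile backward RSS
solution at `α ~ 1` refutes this stub, the crux, `X` and the route at once. Not this line's content. -/
def Sig.stub_spiralLeaf : Prop :=
  ∀ (C : ℝ) (u : ℝ → E3 → E3), IsTypeIAncientMild C u →
    ∀ (a : E3) (σ : ℝ) (A : E3 →L[ℝ] E3), (∀ x, inner ℝ (A x) x = 0) → σ ≠ 0 →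
      (∀ t < 0, ∀ x, fderiv ℝ (u t) x (a + σ • x + A x) + σ • u t x +
        (2 * σ * t) • timeDeriv u t x - A (u t x) = 0) →
      ∀ t < 0, ∀ x, u t x = 0

/-- STUB 3 — AXIS NORMAL FORM (rigid conjugation inside `A_C`; size M in Lean). If `u ∈ A_C` is
annihilated by the Killing generator `∇u·(a + Ax) − Au` with `A ≠ 0` skew and `a ⊥ ker A` (pitch zero:
`a = Ac` for some `c`, so the generator is the rotation field `A(x + c)` about the axis `−c + ker A`), then
for some linear isometry `R` of `ℝ³` and some `c`, the conjugate field `w(t, z) = R⁻¹ u(t, Rz − c)` is again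
in `A_C` with the SAME constant and is axisymmetric about the `x₂`-axis in the tree's sense
(`IsAxisymmetric (w t)`: `w(t, R_θ z) = R_θ w(t, z)` for all `θ`). Proof sketch: choose `R` mapping `e₂` to
a unit vector of `ker A` (so `R⁻¹AR = ωJ`, `ω = ±‖A‖ ≠ 0`, `J` the generator of `rotZ`); `w` inherits
joint smoothness, `div w = 0`, the Type-I bound (isometry) and the Oseen identity (the heat kernel is
radial and the Oseen–Koch–Tataru kernel is `O(3)`-equivariant from its closed Gaussian form,
`K(τ, Rz)[Ra, Rb] = R K(τ, z)[a, b]`; change of variables `y = Ry' − c` in the Bochner integrals); the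
transported infinitesimal symmetry `∇w·(Jz) = Jw` integrates along `θ ↦ rotZ θ` (derivative of
`θ ↦ rotZ(−θ) w(t, rotZ θ z)` vanishes) to `IsAxisymmetric`. Why it might FAIL: it does not (kinematics
and covariance only); the cost is the missing tree lemma "oseenKernel is `O(3)`-equivariant". -/
def Sig.stub_axisNormalForm : Prop :=
  ∀ (C : ℝ) (u : ℝ → E3 → E3), IsTypeIAncientMild C u →
    ∀ (a : E3) (A : E3 →L[ℝ] E3), (∀ x, inner ℝ (A x) x = 0) → A ≠ 0 →
      (∀ e : E3, A e = 0 → inner ℝ a e = 0) →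
      (∀ t < 0, ∀ x, fderiv ℝ (u t) x (a + A x) - A (u t x) = 0) →
      ∃ (R : E3 ≃ₗᵢ[ℝ] E3) (c : E3),
        IsTypeIAncientMild C (fun t z => R.symm (u t (R z - c))) ∧
        ∀ t < 0, IsAxisymmetric (fun z => R.symm (u t (R z - c)))

/-- STUB 4 — THE SWIRL BARRIER FROM `t = −∞` (THE LEVER of this line; size M in Lean). For an
axisymmetric element of `A_C` the scale-invariant swirl `Γ = swirl (u t) = x₀u₁ − x₁u₀ = r u_θ` is bounded
by the explicit constant `2C²`, i.e. `|u_θ| ≤ 2C²/r` — the swirl half of KNSS Thm 5.3's hypothesis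
`|u| ≤ C/|x'|`, for free. Proof: on every window `(t₁, 0)` the field is a classical solution with an
axisymmetric pressure (`IsTypeIAncientMild.exists_isClassicalNSSolutionOn_Ioo`,
`IsClassicalNSSolutionOn.isAxisymmetricScalar_pressure`), so `Γ` solves
`Γ_t + u·∇Γ + (2/r)Γ_r = ΔΓ` off the axis (`swirl_transport_holds`, KNSS (5.10)) and `Γ = 0` on the axis;
`ψ_s(t,x) = (C/√(−s))(r + 2C(√(−s) − √(−t)))` is a strict supersolution on `[s, t₀] × {r > 0}` because
`|u_r| ≤ ‖u‖ ≤ C/√(−t)`, and `ψ_s ≥ Γ` at `t = s` (`|Γ| ≤ r‖u‖`) and on the axis; the weak maximum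
principle in the linear-growth class with the barrier `εe^{μ(t−s)}(1 + |x|²)`, `μ > 2 + C/√(−t₀)`
(pattern of `SwirlMaximumPrinciple.weak_max_principle`, whose drift may be unbounded: only
`∇w = 0, Δw ≤ 0 ⇒ wₜ ≤ 0` is used at interior points, `r > 0`) gives `±Γ ≤ ψ_s` on `[s, t₀] × ℝ³`;
`s → −∞` at fixed `(t, x)` gives `|Γ(t,x)| ≤ 2C²`. Why it might FAIL: it should not — the three-line
supersolution identity was re-derived by all three triagers and machine-checked (kit j009045 I3/I4,
j010063 T4, j010108 I3–I5); the only work is the comparison principle, standard. Uses the Type-I bound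
at time `s → −∞` essentially (void for bounded fields and FALSE on finite windows: Disproof
`_false_with_bounded`, `_false_on_window`). -/
def Sig.stub_swirlBarrier : Prop :=
  ∀ (C : ℝ) (u : ℝ → E3 → E3), IsTypeIAncientMild C u →
    (∀ t < 0, IsAxisymmetric (u t)) →
    ∀ t < 0, ∀ x, |swirl (u t) x| ≤ 2 * C ^ 2

/-- STUB 5 — AXISYMMETRIC FAR FIELD ("Lemma A-axis" of the sibling lines; size M–L in Lean; shared
input of both residual routes of stub 6). An axisymmetric element of `A_C` is `o(1/√(−t))` far from the
axis in parabolic units: for every `ε > 0` there is `ρ` with `√(−t)‖u(t,x)‖ ≤ ε` whenever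
`r = cylRadius x ≥ ρ√(−t)`. Proof (verified by all three triagers, TRIAGE-r1-1 S5, r1-2 §B, r1-3): if
`√(−t_n)‖u(t_n,x_n)‖ ≥ ε` with `ρ_n = r_n/√(−t_n) → ∞`, rescale to `t_n = −1` and translate `x_n` to the
origin — scalings, translations and backward time shifts preserve `A_C` with the SAME `C` — so the new
field is annihilated by the generator `(Jx_n, 0, J)` with `‖Jx_n‖ = ρ_n → ∞`; dividing by `ρ_n` and passing
to a `C¹_loc` limit in `A_C` (sequential compactness of `A_C`: Arzelà–Ascoli from the UNIFORM KNSS Prop.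
4.1 bounds + dominated convergence in the Oseen identity, `|K| ≤ C₀(√τ + |z|)⁻⁴`,
`exists_norm_oseenKernel_le`) yields a nonzero element annihilated by a pure translation — impossible by
the translation leaf (tree theorem `KNSS2009_typeI_rate_liouville_holds` on the windows `ū(· − δ)`).
Why it might FAIL as a proof: the uniform-in-`C` smoothing behind the compactness is print-only
(`knss2009_smoothing_holds` has per-solution constants; `knss2009_local_smoothing_holds` carries uniform
ones — bookkeeping, not a gap). Stated per solution (the uniform version over `A_C` is what the proof
gives). The STATEMENT is implied by the crux. -/
def Sig.stub_axisFarField : Prop :=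
  ∀ (C : ℝ) (u : ℝ → E3 → E3), IsTypeIAncientMild C u →
    (∀ t < 0, IsAxisymmetric (u t)) →
    ∀ ε > 0, ∃ ρ : ℝ, ∀ t < 0, ∀ x, ρ * Real.sqrt (-t) ≤ cylRadius x →
      Real.sqrt (-t) * ‖u t x‖ ≤ ε

/-- STUB 6 — SWIRL LIOUVILLE IN THE TYPE-I ANCIENT CLASS (the RESIDUAL of this line; size L; hardest
OWN stub). An axisymmetric element of `A_C` whose scale-invariant swirl `Γ = r u_θ` is BOUNDED (stub 4)
and whose far field is small in parabolic units (stub 5) has `Γ ≡ 0`. This is the core (5.12)–(5.20) of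
KNSS's proof of Thm 5.3 — in the tree the LINEAR Liouville statement `KNSS2009_swirl_sup_nonpos` (proved
in `KNSSThm53OfWindow` for drifts `r‖u‖ ≤ K`) — to be re-run for abstract elements of `A_C`, where
KNSS's second use of `|u| ≤ C/|x'|` (the drift bound `C/δ` on the annular cylinders
`{δ ≤ r ≤ δ+R} × {|z−z̄| ≤ L} × (t̄−T₁, t̄)`, uniform under the rescaling of a near-maximum point of `Γ` to
unit distance from the axis) is not available a priori. Two routes (either closes the stub):
(R-a) FAR-FIELD LAW = the sibling line: the Oseen bootstrap (Lemma B-axis of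
`stabiliser-at-infinity-decay` / B2 of `farfield-recentring-critical-rate`; master inequality
`m(L) ≤ K₁m(L/4)² + (K₂/L)∫₀ᴸm²`, no log loss in the axis geometry per TRIAGE-r1-2 §C, r1-3) upgrades the
hypothesis `m → 0` (stub 5) to `r‖u‖ ≤ K`; then the tree theorem `knss_bound_C_over_r_holds` (KNSS Thm
5.3) on the windows `u(· − δ)` gives `u ≡ 0`, a fortiori `Γ ≡ 0` (on this route the barrier is redundant).
(R-b) DIRECT, using the barrier: `M = sup|Γ| < ∞` is given; at a near-maximum point `P̄ = (x̄, t̄)` of `Γ`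
at parabolic position `ρ̄ = r̄/√(−t̄)`, rescaling `P̄` to distance `d` from the axis (`λ = r̄/d`) turns the
Type-I bound into `‖u_λ(y,s)‖ ≤ C/√(d²/ρ̄² − s) ≤ Cρ̄/d` on the WHOLE past of `P̄`: if near-maximum points
exist with `ρ̄` bounded, Lemma 2.1 (`KNSS2009_lemma21_holds`) and (5.12)–(5.20) run VERBATIM. In the
remaining "Type-I tornado" regime (`sup Γ` approached only as `ρ̄ → ∞`) the rescaled drift on the annular
block obeys `‖u_λ(y,s)‖ ≤ η(s)/√(−s)` with `η(s) = sup{ε(ρ) : ρ ≳ 1/√(−s)} → 0` as `s → 0⁻` by STUB 5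
(far-field modulus `ε(ρ) → 0`), i.e. a VANISHING multiple of the critical profile near the top: Lemma 2.1
then holds whenever the drift is in the parabolic Kato class — `∫₀ η(s)ds/s < ∞`, i.e. the Dini
condition `∫^∞ ε(ρ)dρ/ρ < ∞` on the far-field modulus — by the two-sided Gaussian bounds for
`∇·(∇u) + b·∇u − uₜ = 0` with Kato-class drift (Q. S. Zhang 1996/1997) and Harnack from Gaussian bounds
(Fabes–Stroock 1986); ANY power rate `ε(ρ) ≲ ρ^{−β}` is Dini, and a power rate is exactly what STAGE 1 of
the sibling bootstrap delivers (`a_{k+1} ≤ Ka_k² + KC²e^{−2^k}` ⇒ `m ≲ L^{−β/2}`, TRIAGE-r1-1 S6) — so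
(R-b) needs the barrier + stub 5 + stage 1 only, not the exponent-doubling to `1/L`.
Why it might FAIL as a proof: (R-a) rests on the full Oseen master inequality (derivation unverified,
TRIAGE-r1-3) ; (R-b) at the borderline (qualitative `ε` only, no Dini rate) needs a Harnack-type lemma
for divergence-free drifts with `‖b(t)‖_∞ ≤ η/√(t̄ − t)`, `η` small but not Dini — not in print: the
parabolic Harnack inequality is known for divergence-free drifts in `L^∞_t(BMO⁻¹_x)`
(Seregin–Silvestre–Šverák–Zlatoš, arXiv:1010.6025, Thm 1.1; Friedlander–Vicol 2011; Nazarov–Ural'tseva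
2012), a critical class which neither contains nor is contained in this one. The STATEMENT is implied by
the crux (an axisymmetric element of `A_C` is annihilated by `(0, 0, J)`). -/
def Sig.stub_swirlLiouville : Prop :=
  ∀ (C : ℝ) (u : ℝ → E3 → E3), IsTypeIAncientMild C u →
    (∀ t < 0, IsAxisymmetric (u t)) →
    (∀ ε > 0, ∃ ρ : ℝ, ∀ t < 0, ∀ x, ρ * Real.sqrt (-t) ≤ cylRadius x →
      Real.sqrt (-t) * ‖u t x‖ ≤ ε) →
    (∃ M : ℝ, ∀ t < 0, ∀ x, |swirl (u t) x| ≤ M) →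
    ∀ t < 0, ∀ x, swirl (u t) x = 0

/-- NO-SWIRL ENDGAME — NOT A STUB: PROVED below as `noSwirlEndgame` (kept under the `Sig.stub_*` naming
of gen 0 of this file for the card's numbering "step 7"). A swirl-free axisymmetric element of `A_C`
vanishes: for every `δ > 0` the window field `u(· − δ)` is a BOUNDED
ancient mild solution (`IsTypeIAncientMild.isBoundedAncientMildSolution_sub`, measurable slices
`aestronglyMeasurable_slice`), axisymmetric and swirl-free at every `t < 0`, so KNSS 2009 Thm 5.2 in
the tree's duality form (THEOREM `knss_axisymmetric_no_swirl'_holds`) makes every slice a.e. constant,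
hence constant (continuous slices), and the gauge kills slice-constant elements
(`IsTypeIAncientMild.comp_sub_right`, `IsTypeIAncientMild.eq_zero_of_slice_const`); `δ → 0`.
Why it might FAIL: it does not; without the gauge it is FALSE (the parasitic field `(1−t)⁻¹e_z` is
axisymmetric, swirl-free and Type-I: Disproof `_false_without_mild`). -/
def Sig.stub_noSwirlEndgame : Prop :=
  ∀ (C : ℝ) (u : ℝ → E3 → E3), IsTypeIAncientMild C u →
    (∀ t < 0, IsAxisymmetric (u t)) →
    (∀ t < 0, ∀ x, swirl (u t) x = 0) →
    ∀ t < 0, ∀ x, u t x = 0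

/-! ### Registered obligations

The six `theorem stub_<name>` below carry their signatures EXPLICITLY and in fully qualified tree
vocabulary (no `open`, no local abbreviation), byte-for-byte the text a `Theorems/` file must restate
to land the stub `--supports stmt-NavierStokesRegularity-4053` (the gate matches name + signature);
each is definitionally `Sig.stub_<name>` above (`stubs_are_sigs`). -/

/-- Registered stub 1 (screw leaf: translations + helical; foreign/known). Signature =
`Sig.stub_screwLeaf` written out. -/
theorem stub_screwLeaf :
    ∀ (C : ℝ) (u : ℝ → EuclideanSpace ℝ (Fin 3) → EuclideanSpace ℝ (Fin 3)),
      Literature.Analysis.FluidPDE.IsTypeIAncientMild C u →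
      ∀ (a : EuclideanSpace ℝ (Fin 3)) (A : EuclideanSpace ℝ (Fin 3) →L[ℝ] EuclideanSpace ℝ (Fin 3)),
        (∀ x, inner ℝ (A x) x = 0) →
        (∃ e : EuclideanSpace ℝ (Fin 3), A e = 0 ∧ inner ℝ a e ≠ 0) →
        (∀ t < 0, ∀ x, fderiv ℝ (u t) x (a + A x) - A (u t x) = 0) →
        ∀ t < 0, ∀ x, u t x = 0 := by
  sorry

/-- Registered stub 2 (spiral-scaling leaf; foreign, contains the open Pineau–Vicol window).
Signature = `Sig.stub_spiralLeaf` written out. -/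
theorem stub_spiralLeaf :
    ∀ (C : ℝ) (u : ℝ → EuclideanSpace ℝ (Fin 3) → EuclideanSpace ℝ (Fin 3)),
      Literature.Analysis.FluidPDE.IsTypeIAncientMild C u →
      ∀ (a : EuclideanSpace ℝ (Fin 3)) (σ : ℝ) (A : EuclideanSpace ℝ (Fin 3) →L[ℝ] EuclideanSpace ℝ (Fin 3)),
        (∀ x, inner ℝ (A x) x = 0) → σ ≠ 0 →
        (∀ t < 0, ∀ x, fderiv ℝ (u t) x (a + σ • x + A x) + σ • u t x +
          (2 * σ * t) • Literature.Analysis.FluidPDE.timeDeriv u t x - A (u t x) = 0) →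
        ∀ t < 0, ∀ x, u t x = 0 := by
  sorry

/-- Registered stub 3 (axis normal form by rigid conjugation inside the class). Signature =
`Sig.stub_axisNormalForm` written out. -/
theorem stub_axisNormalForm :
    ∀ (C : ℝ) (u : ℝ → EuclideanSpace ℝ (Fin 3) → EuclideanSpace ℝ (Fin 3)),
      Literature.Analysis.FluidPDE.IsTypeIAncientMild C u →
      ∀ (a : EuclideanSpace ℝ (Fin 3)) (A : EuclideanSpace ℝ (Fin 3) →L[ℝ] EuclideanSpace ℝ (Fin 3)),
        (∀ x, inner ℝ (A x) x = 0) → A ≠ 0 →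
        (∀ e : EuclideanSpace ℝ (Fin 3), A e = 0 → inner ℝ a e = 0) →
        (∀ t < 0, ∀ x, fderiv ℝ (u t) x (a + A x) - A (u t x) = 0) →
        ∃ (R : EuclideanSpace ℝ (Fin 3) ≃ₗᵢ[ℝ] EuclideanSpace ℝ (Fin 3)) (c : EuclideanSpace ℝ (Fin 3)),
          Literature.Analysis.FluidPDE.IsTypeIAncientMild C (fun t z => R.symm (u t (R z - c))) ∧
          ∀ t < 0, Literature.Analysis.FluidPDE.IsAxisymmetric (fun z => R.symm (u t (R z - c))) := by
  sorry

/-- Registered stub 4 (the swirl barrier from `t = −∞`: THE LEVER). Signature = `Sig.stub_swirlBarrier`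
written out. -/
theorem stub_swirlBarrier :
    ∀ (C : ℝ) (u : ℝ → EuclideanSpace ℝ (Fin 3) → EuclideanSpace ℝ (Fin 3)),
      Literature.Analysis.FluidPDE.IsTypeIAncientMild C u →
      (∀ t < 0, Literature.Analysis.FluidPDE.IsAxisymmetric (u t)) →
      ∀ t < 0, ∀ x, |Literature.Analysis.FluidPDE.swirl (u t) x| ≤ 2 * C ^ 2 := by
  sorry

/-- Registered stub 5 (axisymmetric far field: Lemma A-axis, shared input of both residual routes).
Signature = `Sig.stub_axisFarField` written out. -/
theorem stub_axisFarField :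
    ∀ (C : ℝ) (u : ℝ → EuclideanSpace ℝ (Fin 3) → EuclideanSpace ℝ (Fin 3)),
      Literature.Analysis.FluidPDE.IsTypeIAncientMild C u →
      (∀ t < 0, Literature.Analysis.FluidPDE.IsAxisymmetric (u t)) →
      ∀ ε > 0, ∃ ρ : ℝ, ∀ t < 0, ∀ x,
        ρ * Real.sqrt (-t) ≤ Literature.Analysis.FluidPDE.cylRadius x →
        Real.sqrt (-t) * ‖u t x‖ ≤ ε := by
  sorry

/-- Registered stub 6 (swirl Liouville in the Type-I ancient class: the residual, hardest own stub).
Signature = `Sig.stub_swirlLiouville` written out. -/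
theorem stub_swirlLiouville :
    ∀ (C : ℝ) (u : ℝ → EuclideanSpace ℝ (Fin 3) → EuclideanSpace ℝ (Fin 3)),
      Literature.Analysis.FluidPDE.IsTypeIAncientMild C u →
      (∀ t < 0, Literature.Analysis.FluidPDE.IsAxisymmetric (u t)) →
      (∀ ε > 0, ∃ ρ : ℝ, ∀ t < 0, ∀ x,
        ρ * Real.sqrt (-t) ≤ Literature.Analysis.FluidPDE.cylRadius x →
        Real.sqrt (-t) * ‖u t x‖ ≤ ε) →
      (∃ M : ℝ, ∀ t < 0, ∀ x, |Literature.Analysis.FluidPDE.swirl (u t) x| ≤ M) →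
      ∀ t < 0, ∀ x, Literature.Analysis.FluidPDE.swirl (u t) x = 0 := by
  sorry

/-- **The no-swirl endgame is PROVED here** (it was the idea card's `AxisymmetricLeafOfCOverR`-type
"known" step; S–M): a swirl-free axisymmetric element of `A_C` vanishes. For `δ > 0` the window field
`s ↦ u(s − δ)` is a BOUNDED ancient mild solution (`IsTypeIAncientMild.isBoundedAncientMildSolution_sub`)
with measurable, axisymmetric, swirl-free slices, so KNSS 2009 Thm 5.2 in the tree's duality form
(THEOREM `knss_axisymmetric_no_swirl'_holds`) makes every slice a.e. constant, hence constant (continuous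
slices, `MeasureTheory.Measure.eq_of_ae_eq`), and the gauge kills slice-constant elements
(`IsTypeIAncientMild.eq_zero_of_slice_const` applied to the shifted field, which is in `A_C` by
`comp_sub_right`). Not a stub. -/
theorem noSwirlEndgame : Sig.stub_noSwirlEndgame := by
  intro C u hu hax hsw t ht x
  set δ : ℝ := -t / 2 with hδ
  have hδ0 : 0 < δ := by rw [hδ]; linarith
  have hv : IsTypeIAncientMild C (fun s => u (s - δ)) := hu.comp_sub_right hδ0.le
  have hvb : IsBoundedAncientMildSolution 1 (fun s => u (s - δ)) :=
    hu.isBoundedAncientMildSolution_sub hδ0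
  have hconst : ∀ s < (0 : ℝ), ∃ b : E3, (fun s => u (s - δ)) s =ᵐ[volume] fun _ => b :=
    knss_axisymmetric_no_swirl'_holds hvb (fun s hs => hv.aestronglyMeasurable_slice hs)
      (fun s hs => hax (s - δ) (by linarith)) (fun s hs y => hsw (s - δ) (by linarith) y)
  have hub : ∀ s < (0 : ℝ), ∀ y, (fun s => u (s - δ)) s y = (fun s => u (s - δ) (0 : E3)) s := by
    intro s hs y
    obtain ⟨b, hb⟩ := hconst s hs
    have heq : (fun s => u (s - δ)) s = fun _ => b :=
      MeasureTheory.Measure.eq_of_ae_eq hb (hv.continuous_slice hs) continuous_const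
    have h1 := congrFun heq y
    have h2 := congrFun heq 0
    simp only at h1 h2 ⊢
    rw [h1, h2]
  have hz := hv.eq_zero_of_slice_const hub (t := t + δ) (by rw [hδ]; linarith) x
  simpa using hz

/-- The registered obligations ARE the signatures (definitional check). -/
theorem stubs_are_sigs :
    (Sig.stub_screwLeaf ↔ ∀ (C : ℝ) (u : ℝ → E3 → E3), IsTypeIAncientMild C u →
      ∀ (a : E3) (A : E3 →L[ℝ] E3), (∀ x, inner ℝ (A x) x = 0) →
        (∃ e : E3, A e = 0 ∧ inner ℝ a e ≠ 0) →
        (∀ t < 0, ∀ x, fderiv ℝ (u t) x (a + A x) - A (u t x) = 0) → ∀ t < 0, ∀ x, u t x = 0) ∧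
    (Sig.stub_swirlBarrier ↔ ∀ (C : ℝ) (u : ℝ → E3 → E3), IsTypeIAncientMild C u →
      (∀ t < 0, IsAxisymmetric (u t)) → ∀ t < 0, ∀ x, |swirl (u t) x| ≤ 2 * C ^ 2) ∧
    (Sig.stub_noSwirlEndgame ↔ ∀ (C : ℝ) (u : ℝ → E3 → E3), IsTypeIAncientMild C u →
      (∀ t < 0, IsAxisymmetric (u t)) → (∀ t < 0, ∀ x, swirl (u t) x = 0) → ∀ t < 0, ∀ x, u t x = 0) :=
  ⟨Iff.rfl, Iff.rfl, Iff.rfl⟩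

/-! ## Algebra of the case split (proved) -/

/-- At `σ = 0` the crux's generator is the Killing generator `∇u·(a + Ax) − Au`. -/
theorem killing_of_sigma_zero {u : ℝ → E3 → E3} {a : E3} {A : E3 →L[ℝ] E3}
    (hsym : ∀ t < 0, ∀ x, fderiv ℝ (u t) x (a + (0 : ℝ) • x + A x) + (0 : ℝ) • u t x +
      (2 * (0 : ℝ) * t) • timeDeriv u t x - A (u t x) = 0) :
    ∀ t < 0, ∀ x, fderiv ℝ (u t) x (a + A x) - A (u t x) = 0 := by
  intro t ht x
  have h := hsym t ht x
  simpa using h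

/-- Conversely, a Killing symmetry is the crux's generator at `σ = 0`. -/
theorem sigma_zero_of_killing {u : ℝ → E3 → E3} {a : E3} {A : E3 →L[ℝ] E3}
    (hK : ∀ t < 0, ∀ x, fderiv ℝ (u t) x (a + A x) - A (u t x) = 0) :
    ∀ t < 0, ∀ x, fderiv ℝ (u t) x (a + (0 : ℝ) • x + A x) + (0 : ℝ) • u t x +
      (2 * (0 : ℝ) * t) • timeDeriv u t x - A (u t x) = 0 := by
  intro t ht x
  have h := hK t ht x
  simpa using h

/-- If `a` is orthogonal to the kernel of `A` and `A = 0`, then `a = 0` (so `ξ = (a, 0, A) = 0`). -/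
theorem a_eq_zero_of_perp_ker_of_A_eq_zero {a : E3} {A : E3 →L[ℝ] E3}
    (hperp : ∀ e : E3, A e = 0 → inner ℝ a e = 0) (hA : A = 0) : a = 0 := by
  subst hA
  have h : inner ℝ a a = 0 := hperp a (by simp)
  exact inner_self_eq_zero.1 h

/-- Transfer back along the rigid motion: if the conjugate field `z ↦ R⁻¹ u(t, Rz − c)` vanishes on
`t < 0`, so does `u`. -/
theorem vanishes_of_conjugate_vanishes {u : ℝ → E3 → E3} (R : E3 ≃ₗᵢ[ℝ] E3) (c : E3)
    (hw : ∀ t < 0, ∀ z, R.symm (u t (R z - c)) = 0) : ∀ t < 0, ∀ x, u t x = 0 := by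
  intro t ht x
  have key : R.symm (u t x) = 0 := by
    have h := hw t ht (R.symm (x + c))
    simpa using h
  simpa using congrArg R key

/-! ## The composition: the six stubs give the crux BY NAME -/

/-- **The line.** `ScrewLeaf → SpiralLeaf → AxisNormalForm → SwirlBarrier → AxisFarField →
SwirlLiouville → SymmetricLiouville` (the no-swirl endgame being proved). Pure logic: let `u ∈ A_C` be annihilated by
`ξ = (a, σ, A) ≠ 0`, `A` skew. If `σ ≠ 0`: stub 2. If `σ = 0` the generator is Killing; if `⟪a, e⟫ ≠ 0`
for some `e ∈ ker A` (translation or nonzero pitch): stub 1. Otherwise `a ⊥ ker A`, hence `A ≠ 0` (else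
`a = 0` and `ξ = 0`) and the symmetry is a rotation about a shifted, tilted axis: stub 3 conjugates `u`
into an axisymmetric `w ∈ A_C`, stub 4 bounds its swirl by `2C²`, stub 5 makes its far field small,
stub 6 kills the swirl, the proved endgame `noSwirlEndgame` kills `w`, and `u` vanishes with `w`. -/
theorem SymmetricLiouville_of :
    Sig.stub_screwLeaf → Sig.stub_spiralLeaf → Sig.stub_axisNormalForm → Sig.stub_swirlBarrier →
      Sig.stub_axisFarField → Sig.stub_swirlLiouville → SymmetricLiouville := by
  intro h1 h2 h3 h4 h5 h6 C u hu a σ A hA hne hsym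
  have hu' : IsTypeIAncientMild C u := isTypeIAncientMild_iff.2 hu
  by_cases hσ : σ = 0
  · subst hσ
    have hK : ∀ t < 0, ∀ x, fderiv ℝ (u t) x (a + A x) - A (u t x) = 0 :=
      killing_of_sigma_zero hsym
    by_cases hscrew : ∃ e : E3, A e = 0 ∧ inner ℝ a e ≠ 0
    · exact h1 C u hu' a A hA hscrew hK
    · push Not at hscrew
      have hA0 : A ≠ 0 := by
        intro hA0
        exact hne ⟨a_eq_zero_of_perp_ker_of_A_eq_zero hscrew hA0, rfl, hA0⟩
      obtain ⟨R, c, hw, hax⟩ := h3 C u hu' a A hA hA0 hscrew hK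
      have hΓ := h4 C (fun t z => R.symm (u t (R z - c))) hw hax
      have hfar := h5 C (fun t z => R.symm (u t (R z - c))) hw hax
      have hΓ0 := h6 C (fun t z => R.symm (u t (R z - c))) hw hax hfar ⟨2 * C ^ 2, hΓ⟩
      have hw0 := noSwirlEndgame C (fun t z => R.symm (u t (R z - c))) hw hax hΓ0
      exact vanishes_of_conjugate_vanishes R c hw0
  · exact h2 C u hu' a σ A hA hσ hsym

/-- The skeleton instantiated on the registered stubs: it becomes the crux proof when the last
`stub_*` is discharged (until then it depends on `sorryAx` through the stubs only). -/
theorem SymmetricLiouville_proof : SymmetricLiouville :=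
  SymmetricLiouville_of stub_screwLeaf stub_spiralLeaf stub_axisNormalForm stub_swirlBarrier
    stub_axisFarField stub_swirlLiouville

/-! ## The same stubs close the route's on-path END leaves BY NAME (sorry-free)

Since route rev 8 (2026-08-16T02:26Z) the deciding theorem `closes` of `SymmetryModuliCount` no longer
takes `SymmetricLiouville` but the two Killing END leaves `AxisymEndLiouville` (stmt-14061, crux r4) and
`HelicalEndLiouville` (stmt-14062, crux r7). The stubs of this line prove both, verbatim, after a backward
time shift (`IsTypeIAncientMild.comp_sub_right`): stubs 3–6 + `noSwirlEndgame` give the axisymmetric end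
leaf (THIS line's content), stub 1 gives the helical/translational end leaf (foreign). -/

/-- VERBATIM the route decl `Theses.SymmetryModuliCount.AxisymEndLiouville` (item
stmt-NavierStokesRegularity-14061, rev 8): axisymmetric leaf on a backward end, any axis. Kept as a
local copy so that this file elaborates against either revision of the route file; it is `Iff.rfl`
with the route decl. -/
def AxisymEndLiouvilleItem : Prop :=
  ∀ (C : ℝ) (u : ℝ → EuclideanSpace ℝ (Fin 3) → EuclideanSpace ℝ (Fin 3)),
    Literature.Analysis.FluidPDE.IsTypeIAncientMild C u →
    ∀ (c : EuclideanSpace ℝ (Fin 3)) (A : EuclideanSpace ℝ (Fin 3) →L[ℝ] EuclideanSpace ℝ (Fin 3)) (θ : ℝ),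
      (∀ x, inner ℝ (A x) x = 0) → A ≠ 0 → θ ≤ 0 →
      (∀ t < θ, ∀ x, fderiv ℝ (u t) x (A (x - c)) - A (u t x) = 0) → ∀ t < θ, ∀ x, u t x = 0

/-- VERBATIM the route decl `Theses.SymmetryModuliCount.HelicalEndLiouville` (item
stmt-NavierStokesRegularity-14062, rev 8): helical / translational leaf on a backward end. `Iff.rfl`
with the route decl. -/
def HelicalEndLiouvilleItem : Prop :=
  ∀ (C : ℝ) (u : ℝ → EuclideanSpace ℝ (Fin 3) → EuclideanSpace ℝ (Fin 3)),
    Literature.Analysis.FluidPDE.IsTypeIAncientMild C u →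
    ∀ (a : EuclideanSpace ℝ (Fin 3)) (A : EuclideanSpace ℝ (Fin 3) →L[ℝ] EuclideanSpace ℝ (Fin 3)) (θ : ℝ),
      (∀ x, inner ℝ (A x) x = 0) → a ∉ Set.range A → θ ≤ 0 →
      (∀ t < θ, ∀ x, fderiv ℝ (u t) x (a + A x) - A (u t x) = 0) → ∀ t < θ, ∀ x, u t x = 0

/-- Polarisation of skewness: `⟪Ax, y⟫ = −⟪Ay, x⟫`. -/
theorem inner_skew_swap {A : E3 →L[ℝ] E3} (hA : ∀ x, inner ℝ (A x) x = 0) (x y : E3) :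
    inner ℝ (A x) y = -inner ℝ (A y) x := by
  have h := hA (x + y)
  rw [map_add, inner_add_left, inner_add_right, inner_add_right, hA x, hA y] at h
  linarith

/-- For a skew `A` on `ℝ³`, `range A = (ker A)ᗮ`; hence a vector outside the range pairs
nontrivially with some kernel vector (translation, or screw of nonzero pitch). -/
theorem exists_ker_inner_ne_zero_of_not_mem_range {A : E3 →L[ℝ] E3} (hA : ∀ x, inner ℝ (A x) x = 0)
    {a : E3} (ha : a ∉ Set.range A) : ∃ e : E3, A e = 0 ∧ inner ℝ a e ≠ 0 := by
  by_contra hcon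
  push Not at hcon
  apply ha
  -- `range A ≤ (ker A)ᗮ` by skewness, with equal dimensions, hence equality
  have hle : LinearMap.range (A : E3 →ₗ[ℝ] E3) ≤ (LinearMap.ker (A : E3 →ₗ[ℝ] E3))ᗮ := by
    rintro _ ⟨x, rfl⟩
    rw [Submodule.mem_orthogonal]
    intro e he
    rw [LinearMap.mem_ker, ContinuousLinearMap.coe_coe] at he
    rw [ContinuousLinearMap.coe_coe, real_inner_comm, inner_skew_swap hA, he, inner_zero_left,
      neg_zero]
  have h1 := LinearMap.finrank_range_add_finrank_ker (A : E3 →ₗ[ℝ] E3)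
  have h2 := Submodule.finrank_add_finrank_orthogonal (LinearMap.ker (A : E3 →ₗ[ℝ] E3))
  have heq : LinearMap.range (A : E3 →ₗ[ℝ] E3) = (LinearMap.ker (A : E3 →ₗ[ℝ] E3))ᗮ :=
    Submodule.eq_of_le_of_finrank_eq hle (by omega)
  have hmem : a ∈ (LinearMap.ker (A : E3 →ₗ[ℝ] E3))ᗮ := by
    rw [Submodule.mem_orthogonal]
    intro e he
    rw [LinearMap.mem_ker, ContinuousLinearMap.coe_coe] at he
    rw [real_inner_comm]
    exact hcon e he
  rw [← heq, LinearMap.mem_range] at hmem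
  obtain ⟨y, hy⟩ := hmem
  exact ⟨y, by simpa using hy⟩

/-- **Stubs 3–6 (+ the proved endgame) ⇒ `AxisymEndLiouville`** (route item stmt-NavierStokesRegularity-14061, a hypothesis
of `closes`; stated on the verbatim copy `AxisymEndLiouvilleItem`): shift the end `t < θ` to the whole past (`u(· + θ) ∈ A_C`, same `C`), rewrite the
rotation `A(x − c)` as the Killing generator `−Ac + Ax` with `−Ac ⊥ ker A` (skewness), and run the
axis chain of `SymmetricLiouville_of`. -/
theorem AxisymEndLiouville_of :
    Sig.stub_axisNormalForm → Sig.stub_swirlBarrier → Sig.stub_axisFarField →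
      Sig.stub_swirlLiouville → AxisymEndLiouvilleItem := by
  intro h3 h4 h5 h6 C u hu c A θ hA hA0 hθ hsym t ht x
  have hv : IsTypeIAncientMild C (fun s => u (s - -θ)) := hu.comp_sub_right (by linarith)
  have hperp : ∀ e : E3, A e = 0 → inner ℝ (-(A c)) e = 0 := by
    intro e he
    rw [inner_neg_left, inner_skew_swap hA c e, he, inner_zero_left, neg_neg]
  have hsymv : ∀ s < 0, ∀ y, fderiv ℝ (u (s - -θ)) y (-(A c) + A y) - A (u (s - -θ) y) = 0 := by
    intro s hs y
    have key := hsym (s - -θ) (by linarith) y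
    have e : A (y - c) = -(A c) + A y := by rw [map_sub]; abel
    rw [e] at key
    exact key
  obtain ⟨R, c', hw, hax⟩ := h3 C (fun s => u (s - -θ)) hv (-(A c)) A hA hA0 hperp hsymv
  have hΓ := h4 C (fun t z => R.symm ((fun s => u (s - -θ)) t (R z - c'))) hw hax
  have hfar := h5 C (fun t z => R.symm ((fun s => u (s - -θ)) t (R z - c'))) hw hax
  have hΓ0 := h6 C (fun t z => R.symm ((fun s => u (s - -θ)) t (R z - c'))) hw hax hfar
    ⟨2 * C ^ 2, hΓ⟩
  have hw0 := noSwirlEndgame C (fun t z => R.symm ((fun s => u (s - -θ)) t (R z - c'))) hw hax hΓ0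
  have hv0 : ∀ s < 0, ∀ y, (fun s => u (s - -θ)) s y = 0 := vanishes_of_conjugate_vanishes R c' hw0
  have key := hv0 (t - θ) (by linarith) x
  have e : t - θ - -θ = t := by ring
  simpa [e] using key

/-- **Stub 1 ⇒ `HelicalEndLiouville`** (route item stmt-NavierStokesRegularity-14062, a hypothesis of
`closes`; stated on the verbatim copy `HelicalEndLiouvilleItem`): shift the end to the whole past and convert `a ∉ range A` into `⟪a, e⟫ ≠ 0` for some
`e ∈ ker A` (`exists_ker_inner_ne_zero_of_not_mem_range`). -/
theorem HelicalEndLiouville_of : Sig.stub_screwLeaf → HelicalEndLiouvilleItem := by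
  intro h1 C u hu a A θ hA ha hθ hsym t ht x
  have hv : IsTypeIAncientMild C (fun s => u (s - -θ)) := hu.comp_sub_right (by linarith)
  have hsymv : ∀ s < 0, ∀ y, fderiv ℝ (u (s - -θ)) y (a + A y) - A (u (s - -θ) y) = 0 :=
    fun s hs y => hsym (s - -θ) (by linarith) y
  have hv0 := h1 C (fun s => u (s - -θ)) hv a A hA (exists_ker_inner_ne_zero_of_not_mem_range hA ha)
    hsymv
  have key := hv0 (t - θ) (by linarith) x
  have e : t - θ - -θ = t := by ring
  simpa [e] using key

/-! ## Sanity (sorry-free): the foreign leaves are special cases of the crux; non-vacuity -/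

/-- The crux implies stub 1 (`σ = 0`; `ξ ≠ 0` because `a ≠ 0`). -/
theorem symmetricLiouville_implies_screwLeaf : SymmetricLiouville → Sig.stub_screwLeaf := by
  intro h C u hu a A hA hscrew hK
  obtain ⟨e, hAe, hae⟩ := hscrew
  have ha0 : a ≠ 0 := by
    rintro rfl
    exact hae (by simp)
  exact h C u (isTypeIAncientMild_iff.1 hu) a 0 A hA (fun hz => ha0 hz.1) (sigma_zero_of_killing hK)

/-- The crux implies stub 2 (`σ ≠ 0`). -/
theorem symmetricLiouville_implies_spiralLeaf : SymmetricLiouville → Sig.stub_spiralLeaf := by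
  intro h C u hu a σ A hA hσ hsym
  exact h C u (isTypeIAncientMild_iff.1 hu) a σ A hA (fun hz => hσ hz.2.1) hsym

/-- Rotations about the axis fix the origin. -/
theorem rotZ_zero_vec (θ : ℝ) : rotZ θ (0 : E3) = 0 := by
  ext i
  fin_cases i <;> simp [rotZ]

/-- Non-vacuity of the axis stubs 4–6 and of the endgame: `0 ∈ A_C` (`C ≥ 0`) is axisymmetric with zero swirl. -/
theorem stubs_nonvacuous {C : ℝ} (hC : 0 ≤ C) :
    IsTypeIAncientMild C (0 : ℝ → E3 → E3) ∧
      (∀ t < (0 : ℝ), IsAxisymmetric ((0 : ℝ → E3 → E3) t)) ∧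
      ∀ t < (0 : ℝ), ∀ x, swirl ((0 : ℝ → E3 → E3) t) x = 0 := by
  refine ⟨isTypeIAncientMild_zero hC, fun t _ θ x => ?_, fun t _ x => ?_⟩
  · simp [rotZ_zero_vec]
  · simp [swirl]

end Summit.NavierStokesRegularity.NavierStokesRegularity.Cruxes.SymmetricLiouville.SwirlBarrierPast

end
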